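import Summits.Ventures.LatticeQCDFlow.Scaling.TaggedPerAttemptCertificateGlobal
import Summits.Ventures.LatticeQCDFlow.Scaling.TaggedStartContentAboveGlobal

/-!
HONEST FRAMING: exact (Metropolis-corrected) sampling algorithms for lattice gauge theory; figures
of merit are autocorrelation/cost numbers at stated couplings and volumes; no continuum-physics
claim.

# TaggedPerAttemptCertificateBetween — CONJECTURE W′ FROM A HUB BETWEEN THE TWO EXTRA PARTICLES (`W_b ≤ W_z < W_a`, A GLOBAL EDGE) WITH A THIRD PARTICLE AT OR ABOVE `W_z`,
# EVERY `K ≥ 2`: `L·(x̃(★) + (x̃(a) − ỹ(a)) − D_J) ≥ cost(x̃) + cost(ỹ)` FOR EVERY TRUNCATION `J` (lean-2 GEN-42, ours)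

Venture-side (OURS).  Cell `lqcd-flow` (pub-lqcd), unit `pub-lqcd-lean-2-g42`, 2026-08-30.  Chapter AB (route (β), the cost side continued), file 12.  The last hub position on a
global edge: `z` strictly between the extra particles (or at `W_b`).  Chain through the tag position AT `W_z`: the tagged chain `P_Z` with tag content `z` itself and its laws
`ζ_n` are built inside the proof; the lower half-move `(Z,Y)` has its hub AT the upper tag position with a third particle at or above it, hence NO deficit (file 9 (i): `y_n(z) ≤
ζ_n(z)`), so `D^{XY}_J ≤ D^{XZ}_J`; the upper half-move `(X,Z)` is in the deep configuration with `b := z` (`W_z ≤ W_z`, `W_z < W_a`, three particles at or above `z`), any contents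
between `W_z` and `W_a`, and file 6's cost side (with `L` free, `L = L_{XY} ≤ 4K+2`) pays `L·D^{XZ}_J ≤ 2s1` out of `X`'s ★-certificate slack; the incomes `s3`, the gaps and the
start-content term are those of the pair `(a,b)` (W21, W26).

* **`tagged_perAttempt_certificate_between`**: `cost(x̃) + cost(ỹ) ≤ L·(x̃(★) + (x̃(a) − ỹ(a)) − D_J)` for every `J`, for `W_b ≤ W_z < W_a` and (`N_C(z) ≥ 2` or another present content at
  or above `W_z`).

What remains of OPEN-MATH (b′) after files 6, 7b, 10, 11, 12: ONE configuration — the hub ALONE strictly between the extra particles with every other present content strictly below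
it (the subadditive split is lossy there: `e^{XZ} < 0` at odd attempts compensates the odd-attempt deficits of `(Z,Y)`; the signed residual form of GEN-41 file 2 is needed; memo
MEMO-gen42 §5).  Literature grade (cell rule): OWN; nothing cited; no new bib keys.
-/

open Finset

namespace Summit.Ventures.LatticeQCDFlow.Scaling

section Between
variable {S : Type*} [Fintype S] [DecidableEq S]
variable {W θ : S → ℝ} {acc : S → S → ℝ} {p : ℝ} {K : ℕ} {NC : S → ℕ} {a b : S} {PX PY : Option S → Option S → ℝ}

/-- **CONJECTURE W′ FROM A HUB BETWEEN THE EXTRA PARTICLES WITH A THIRD PARTICLE AT OR ABOVE IT, EVERY `K ≥ 2`** (see the module docstring). [ours] -/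
theorem tagged_perAttempt_certificate_between (hW : ∀ v, 0 < W v) (hp0 : 0 ≤ p) (hp : ∀ v, p * W v ≤ 1) (hθ : ∀ v, θ v = 1 / (1 + p * W v))
    (hacc : ∀ h v, acc h v = min 1 (W h / W v)) (hK : 2 ≤ K) (hNC : ∑ v, NC v = K) (hab : W b ≤ W a)
    (hPXoff : ∀ h v, h ≠ v → PX (some h) (some v) = if NC h = 0 then 0 else (NC v : ℝ) / K * acc h v)
    (hPXin : ∀ h, PX (some h) none = if NC h = 0 then 0 else acc h a / K)
    (hPXdiag : ∀ h, PX (some h) (some h) = 1 - (∑ v ∈ univ.erase h, PX (some h) (some v) + PX (some h) none))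
    (hPXout : ∀ v, PX none (some v) = (NC v : ℝ) / K * acc a v) (hPXstay : PX none none = 1 - ∑ v, PX none (some v))
    (hPYoff : ∀ h v, h ≠ v → PY (some h) (some v) = if NC h = 0 then 0 else (NC v : ℝ) / K * acc h v)
    (hPYin : ∀ h, PY (some h) none = if NC h = 0 then 0 else acc h b / K)
    (hPYdiag : ∀ h, PY (some h) (some h) = 1 - (∑ v ∈ univ.erase h, PY (some h) (some v) + PY (some h) none))
    (hPYout : ∀ v, PY none (some v) = (NC v : ℝ) / K * acc b v) (hPYstay : PY none none = 1 - ∑ v, PY none (some v))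
    {z : S} (hz : NC z ≠ 0) (hbz : W b ≤ W z) (hza : W z < W a) (hthree : 2 ≤ NC z ∨ ∃ w, w ≠ z ∧ NC w ≠ 0 ∧ W z ≤ W w)
    {x y : ℕ → Option S → ℝ}
    (hx0 : ∀ v, x 0 v = if v = some z then 1 else 0) (hxs : ∀ n v, x (n + 1) v = ∑ h, x n h * PX h v)
    (hy0 : ∀ v, y 0 v = if v = some z then 1 else 0) (hys : ∀ n v, y (n + 1) v = ∑ h, y n h * PY h v)
    {M : ℝ} (hM : M = ∑ v, θ v * (NC v : ℝ) + θ a) {L : ℝ} (hL : L = 2 * K + M + (∑ v, θ v * (NC v : ℝ) + θ b))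
    {σ : ℝ} (hσ0 : 0 ≤ σ) (hσ1 : σ < 1) {xt yt xs ys : Option S → ℝ}
    (hxt : ∀ t, xt t = (1 - σ) * PX (some z) t + σ * ∑ t', xt t' * PX t' t) (hyt : ∀ t, yt t = (1 - σ) * PY (some z) t + σ * ∑ t', yt t' * PY t' t)
    (hxsr : ∀ t, xs t = (1 - σ) * PX none t + σ * ∑ t', xs t' * PX t' t) (hysr : ∀ t, ys t = (1 - σ) * PY none t + σ * ∑ t', ys t' * PY t' t) (J : ℕ) :
    (∑ v, xt (some v) * (1 - θ v) + xt none * (1 - θ a)) + (∑ v, yt (some v) * (1 - θ v) + yt none * (1 - θ b))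
      ≤ L * (xt none + (xt (some a) - yt (some a)) - ∑ n ∈ range J, (1 - σ) * σ ^ n * max 0 (y (n + 1) (some z) - x (n + 1) (some z))) := by
  have hK1 : 1 ≤ K := by omega
  have hθm := theta_mem hW hp0 hp hθ
  -- the exact decomposition (file 4)
  have hMY : (∑ v, θ v * (NC v : ℝ) + θ b) = M + (θ b - θ a) := by rw [hM]; ring
  have hdec := ledger_perStep_eq (θ := θ) (x := xt) (y := yt) (z := z) (a := a)
    (pen := ∑ n ∈ range J, (1 - σ) * σ ^ n * max 0 (y (n + 1) (some z) - x (n + 1) (some z))) hMY hL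
  -- the incomes
  -- (i) `s3 ≥ 0`
  have hDstar := tagged_star_domination hW hacc hK1 hNC hab hPXoff hPXin hPXdiag hPXout hPXstay hPYoff hPYin hPYdiag hPYout hPYstay hσ0 hσ1 hxsr hysr z
  have hs3 := S2_of_star_domination hW hp0 hp hθ hacc hK1 hNC hab hPXoff hPXin hPXdiag hPXout hPXstay hPYoff hPYin hPYout hσ0 hσ1 hz hxt hyt hxsr hysr hDstar
  -- (ii) domination from the hub at every ordinary content (W26), in particular at `a` and at `z`
  have hdom := tagged_hub_domination hW hacc hK1 hNC hab hPXoff hPXin hPXdiag hPXout hPXstay hPYoff hPYin hPYdiag hPYout hPYstay hσ0 hσ1 hz hxt hyt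
  have hgap_a : 0 ≤ xt (some a) - yt (some a) := by linarith [hdom a]
  have hgaps : 0 ≤ ∑ v ∈ univ.erase z, (xt (some v) - yt (some v)) * (1 - θ v) :=
    sum_nonneg fun v _ => mul_nonneg (by linarith [hdom v]) (by linarith [(hθm v).2])
  have hez : 0 ≤ -((1 - θ z) * (yt (some z) - xt (some z))) := by
    have h1 : 0 ≤ 1 - θ z := by linarith [(hθm z).2]
    have h2 : yt (some z) - xt (some z) ≤ 0 := by linarith [hdom z]
    nlinarith
  -- `0 ≤ L ≤ 4K + 2`
  have hMC : ∑ v, θ v * (NC v : ℝ) ≤ K := by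
    calc ∑ v, θ v * (NC v : ℝ) ≤ ∑ v, (NC v : ℝ) := sum_le_sum fun v _ =>
            mul_le_of_le_one_left (Nat.cast_nonneg _) (hθm v).2
      _ = K := by exact_mod_cast hNC
  have hMC0 : 0 ≤ ∑ v, θ v * (NC v : ℝ) := sum_nonneg fun v _ => mul_nonneg (by linarith [(hθm v).1]) (Nat.cast_nonneg _)
  have hK0 : (0 : ℝ) ≤ K := Nat.cast_nonneg _
  have hL0 : 0 ≤ L := by rw [hL, hM]; linarith only [hMC0, (hθm a).1, (hθm b).1, hK0]
  have hL4 : L ≤ 4 * K + 2 := by rw [hL, hM]; linarith only [hMC, (hθm a).2, (hθm b).2]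
  -- (iii) the cost side through the intermediate tag position AT `z`: the tagged chain `P_Z` with tag content `z` and its laws `ζ_n`
  classical
  obtain ⟨offZ, hoffZ⟩ : ∃ off : S → S → ℝ, ∀ h v, off h v = if NC h = 0 then 0 else (NC v : ℝ) / K * acc h v := ⟨_, fun _ _ => rfl⟩
  obtain ⟨inZ, hinZ⟩ : ∃ f : S → ℝ, ∀ h, f h = if NC h = 0 then 0 else acc h z / K := ⟨_, fun _ => rfl⟩
  obtain ⟨outZ, houtZ⟩ : ∃ f : S → ℝ, ∀ v, f v = (NC v : ℝ) / K * acc z v := ⟨_, fun _ => rfl⟩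
  obtain ⟨PZ, hPZ⟩ : ∃ PZ : Option S → Option S → ℝ, ∀ s t, PZ s t =
      Option.elim s (Option.elim t (1 - ∑ v, outZ v) (fun v => outZ v))
        (fun h => Option.elim t (inZ h) (fun v => if h = v then 1 - (∑ v' ∈ univ.erase h, offZ h v' + inZ h) else offZ h v)) := ⟨_, fun _ _ => rfl⟩
  have hPZoff : ∀ h v, h ≠ v → PZ (some h) (some v) = if NC h = 0 then 0 else (NC v : ℝ) / K * acc h v := fun h v hhv => by
    rw [hPZ]; simp only [Option.elim]; rw [if_neg hhv, hoffZ]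
  have hPZin : ∀ h, PZ (some h) none = if NC h = 0 then 0 else acc h z / K := fun h => by rw [hPZ]; simp only [Option.elim]; rw [hinZ]
  have hPZdiag : ∀ h, PZ (some h) (some h) = 1 - (∑ v ∈ univ.erase h, PZ (some h) (some v) + PZ (some h) none) := fun h => by
    rw [hPZ]; simp only [Option.elim, if_true]; rw [hPZin, hinZ]
    congr 2
    exact sum_congr rfl fun v hv => by rw [hPZoff h v (ne_of_mem_erase hv).symm, hoffZ]
  have hPZout : ∀ v, PZ none (some v) = (NC v : ℝ) / K * acc z v := fun v => by rw [hPZ]; simp only [Option.elim]; rw [houtZ]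
  have hPZstay : PZ none none = 1 - ∑ v, PZ none (some v) := by
    rw [hPZ]; simp only [Option.elim]; congr 1; exact sum_congr rfl fun v _ => by rw [hPZout, houtZ]
  let ζ : ℕ → Option S → ℝ := fun n => Nat.rec (motive := fun _ => Option S → ℝ) (fun v => if v = some z then 1 else 0) (fun _ prev v => ∑ h, prev h * PZ h v) n
  have hζ0 : ∀ v, ζ 0 v = if v = some z then 1 else 0 := fun _ => rfl
  have hζs : ∀ n v, ζ (n + 1) v = ∑ h, ζ n h * PZ h v := fun _ _ => rfl
  -- the lower half-move `(Z,Y)`: the hub sits AT the upper tag position with a third particle at or above it ⇒ no deficit (file 9 (i))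
  obtain ⟨hCZY, -, -, -⟩ := tagged_startClass_above_global hW hacc hK hNC hbz hPZoff hPZin hPZdiag hPZout hPZstay hPYoff hPYin hPYdiag hPYout hPYstay
    hz le_rfl hζ0 hζs hy0 hys (a := z)
  have hno : ∀ n, y n (some z) ≤ ζ n (some z) := hCZY hthree
  -- the upper half-move `(X,Z)`: deep configuration with `b := z` (file 6's cost side with `L` free)
  have hcostXZ := tagged_costSide_global hW hp0 hp hθ hacc hK hNC hza.le hPXoff hPXin hPXdiag hPXout hPXstay hPZoff hPZin hPZdiag hPZout hPZstay
    hz le_rfl hza hthree hx0 hxs hζ0 hζs hM hL0 hL4 hσ0 hσ1 hxt J (b := z)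
  -- `D^{XY}_J ≤ D^{XZ}_J`
  have hDle : ∑ n ∈ range J, (1 - σ) * σ ^ n * max 0 (y (n + 1) (some z) - x (n + 1) (some z))
      ≤ ∑ n ∈ range J, (1 - σ) * σ ^ n * max 0 (ζ (n + 1) (some z) - x (n + 1) (some z)) := by
    refine sum_le_sum fun n _ => mul_le_mul_of_nonneg_left ?_ (mul_nonneg (by linarith) (pow_nonneg hσ0 n))
    exact max_le_max le_rfl (by linarith [hno (n + 1)])
  have hcost : L * ∑ n ∈ range J, (1 - σ) * σ ^ n * max 0 (y (n + 1) (some z) - x (n + 1) (some z))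
      ≤ 2 * ((K + M) * xt none - (∑ v, xt (some v) * (1 - θ v) + xt none * (1 - θ a))) :=
    (mul_le_mul_of_nonneg_left hDle hL0).trans hcostXZ
  -- assemble
  have key : 0 ≤ L * (xt none + (xt (some a) - yt (some a)) - ∑ n ∈ range J, (1 - σ) * σ ^ n * max 0 (y (n + 1) (some z) - x (n + 1) (some z)))
      - (∑ v, xt (some v) * (1 - θ v) + xt none * (1 - θ a)) - (∑ v, yt (some v) * (1 - θ v) + yt none * (1 - θ b)) := by
    rw [hdec]
    have hga : 0 ≤ L * (xt (some a) - yt (some a)) := mul_nonneg hL0 hgap_a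
    nlinarith [hs3, hga, hgaps, hez, hcost]
  linarith

end Between

end Summit.Ventures.LatticeQCDFlow.Scaling
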